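import Mathlib
import Literature.AlgebraicGeometry.Resolution.CobordantGame
import Literature.AlgebraicGeometry.Resolution.FormalCoordinateChange
import Literature.AlgebraicGeometry.Resolution.FormalInverseFunction
import Literature.RingTheory.MvPowerSeries.PartialDerivative
import Summits.ResolutionOfSingularities.ResolutionOfSingularities.Theorems.WeightedInvariantGlobalizeLocalDropCanonize

/-!
# The formal critical section of a hyperbolic pair (Morse lemma with parameters, first half)

Crux `LocalWeightedDrop` (stmt-ResolutionOfSingularities-8899, route
ResolutionOfSingularities/WeightedInvariant), line `hasse-ridge-face-selection`, registered stub
`stub_criticalSection` of the skeleton `LocalWeightedDrop`.  Over ANY field `k`, let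
`f ∈ k[[x₀, …, x_{n+1}]]` be a singular germ (`CobordantGame.IsSingular`) whose tangent quadric
has no `x₀²`, no `x₁²` and a non-zero coefficient `c` at `x₀x₁`.  Then some legal formal
coordinate change `θ` keeps these three quadric coefficients and kills every monomial of degree
exactly one in `(x₀, x₁)`.

Proof (char-free).  `Ψ = (c⁻¹ ∂₁f, c⁻¹ ∂₀f, x₂, …)` (`pd` the formal partial derivatives) has
zero constant terms and unit upper-triangular linear part (as `coeff x₀² = 0`), hence a
compositional inverse `ψ` (`FormalCoordChange.exists_comp_inverse`), `ψᵢ = xᵢ` for `i ≥ 2`; its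
restriction to `x₀ = x₁ = 0` is the CRITICAL SECTION `τ = (A, B, x₂, …)`, `A, B ∈ k[[x₂, …]]`
without constant terms, `(∂₀f)(τ) = 0 = (∂₁f)(τ)` (`exists_section`).  The translation
`θ = (x₀ + A, x₁ + B, x₂, …)` is legal; by the chain rule (`pd_subst`) `∂ⱼ(f∘θ) = (∂ⱼf)∘θ` for
`j = 0, 1`, which restricts to `(∂ⱼf)(τ) = 0` on `x₀ = x₁ = 0`, so the coefficients of `f∘θ` at
`e + eⱼ`, `e` supported in the indices `≥ 2`, vanish (`coeff_subst_shift_eq_zero`); killing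
instead the variables of index `≥ 2` commutes `θ` away, so the coefficients of `f∘θ` at
exponents supported in `{0, 1}` are those of `f` (`coeff_subst_shift_of_near`).  Both
restrictions are INDICATOR SUBSTITUTIONS `σ` (`xᵢ ↦ xᵢ` for `P i`, `xᵢ ↦ 0` otherwise), whose
effect on coefficients is `coeff_subst_indSubst`.  No auxiliary definitions: the families `σ`,
`Ψ`, `θ` enter through their defining equations (hypotheses `hσ`, `hΨ`, `hθ`).
-/

set_option linter.dupNamespace false -- mandated namespace of this single-conjunct summit

namespace Summit.ResolutionOfSingularities.ResolutionOfSingularities.Theorems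

open Literature.AlgebraicGeometry.Resolution

namespace CriticalSection

open MvPowerSeries Literature.RingTheory.MvPowerSeries

variable {k : Type} [Field k] {m : ℕ}

/-! ### Indicator substitutions `σ = (xᵢ if P i, else 0)` -/

variable {P : Fin m → Prop} [DecidablePred P] {σ : Fin m → MvPowerSeries (Fin m) k}
  (hσ : ∀ i, σ i = if P i then X i else 0)

include hσ in
/-- An indicator substitution has zero constant terms. -/
theorem constantCoeff_indSubst (i : Fin m) : constantCoeff (σ i) = 0 := by
  rw [hσ]; split_ifs <;> simp [constantCoeff_X]

include hσ in
/-- An indicator substitution is substitutable. -/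
theorem hasSubst_indSubst : HasSubst σ := hasSubst_of_constantCoeff_zero (constantCoeff_indSubst hσ)

include hσ in
/-- The monomials of an indicator substitution: `xᵈ` if `d` is supported in `P`, else `0`. -/
theorem prod_pow_indSubst (d : Fin m →₀ ℕ) :
    (d.prod fun i e => σ i ^ e) = if ∀ i ∈ d.support, P i then monomial d (1 : k) else 0 := by
  split_ifs with h
  · rw [monomial_one_eq]
    exact Finsupp.prod_congr fun i hi => by rw [hσ, if_pos (h i hi)]
  · push Not at h
    obtain ⟨i, hi, hPi⟩ := h
    rw [Finsupp.prod]
    exact Finset.prod_eq_zero hi (by rw [hσ, if_neg hPi, zero_pow (Finsupp.mem_support_iff.mp hi)])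

include hσ in
/-- COEFFICIENTS UNDER AN INDICATOR SUBSTITUTION: kept at exponents supported in `P`, killed at
the others. -/
theorem coeff_subst_indSubst (v : MvPowerSeries (Fin m) k) (e : Fin m →₀ ℕ) :
    coeff e (subst σ v) = if ∀ i ∈ e.support, P i then coeff e v else 0 := by
  rw [coeff_subst (hasSubst_indSubst hσ), finsum_eq_single _ e]
  · rw [prod_pow_indSubst hσ]
    split_ifs with h
    · rw [coeff_monomial_same, smul_eq_mul, mul_one]
    · rw [map_zero, smul_zero]
  · intro d hd
    rw [prod_pow_indSubst hσ]
    split_ifs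
    · rw [coeff_monomial_ne (Ne.symm hd), smul_zero]
    · rw [map_zero, smul_zero]

include hσ in
/-- Coefficients at exponents supported in `P` are unchanged. -/
theorem coeff_subst_indSubst_of_forall (v : MvPowerSeries (Fin m) k) {e : Fin m →₀ ℕ}
    (he : ∀ i ∈ e.support, P i) : coeff e (subst σ v) = coeff e v := by
  rw [coeff_subst_indSubst hσ, if_pos he]

include hσ in
/-- Coefficients at exponents involving a killed variable vanish. -/
theorem coeff_subst_indSubst_of_not (v : MvPowerSeries (Fin m) k) {e : Fin m →₀ ℕ} {i : Fin m}
    (hi : e i ≠ 0) (hP : ¬ P i) : coeff e (subst σ v) = 0 := by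
  rw [coeff_subst_indSubst hσ, if_neg]
  exact fun h => hP (h i (Finsupp.mem_support_iff.mpr hi))

include hσ in
/-- Indicator substitutions are idempotent. -/
theorem subst_indSubst_idem (v : MvPowerSeries (Fin m) k) : subst σ (subst σ v) = subst σ v := by
  ext e
  rw [coeff_subst_indSubst hσ, coeff_subst_indSubst hσ]
  split_ifs <;> rfl

include hσ in
/-- The partial derivative of a restricted series in a killed direction vanishes. -/
theorem pd_subst_indSubst {j : Fin m} (hj : ¬ P j) (v : MvPowerSeries (Fin m) k) : pd j (subst σ v) = 0 := by
  ext e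
  rw [coeff_pd, coeff_subst_indSubst_of_not hσ v (i := j) (by simp) hj, mul_zero, map_zero]

include hσ in
/-- Two indicator substitutions with disjoint kept sets kill every series without constant term. -/
theorem subst_indSubst_subst_indSubst_of_disjoint {Q : Fin m → Prop} [DecidablePred Q]
    {ρ : Fin m → MvPowerSeries (Fin m) k} (hρ : ∀ i, ρ i = if Q i then X i else 0)
    (hPQ : ∀ i, P i → ¬ Q i) {v : MvPowerSeries (Fin m) k} (hv : constantCoeff v = 0) :
    subst ρ (subst σ v) = 0 := by
  ext e
  rw [map_zero, coeff_subst_indSubst hρ, coeff_subst_indSubst hσ]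
  by_cases he : e = 0
  · subst he
    simp [hv]
  · obtain ⟨i, hi'⟩ := Finsupp.support_nonempty_iff.mpr he
    split_ifs with hQ hP
    · exact absurd (hQ i hi') (hPQ i (hP i hi'))
    · rfl
    · rfl

/-- A unit upper-triangular matrix has invertible determinant. -/
theorem isUnit_det_of_unitriangular (M : Matrix (Fin m) (Fin m) k)
    (htri : ∀ i j, j < i → M i j = 0) (hdiag : ∀ i, M i i = 1) : IsUnit M.det := by
  rw [Matrix.det_of_upperTriangular (fun i j h => htri i j h), Finset.prod_eq_one (fun i _ => hdiag i)]
  exact isUnit_one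

/-- Trichotomy of indices of `Fin (n + 2)`: `0`, `1`, or `≥ 2`. -/
theorem fin_cases_two {n : ℕ} : ∀ i : Fin (n + 2), i = 0 ∨ i = 1 ∨ 2 ≤ (i : ℕ)
  | ⟨0, _⟩ => Or.inl (Fin.ext (by simp))
  | ⟨1, _⟩ => Or.inr (Or.inl (Fin.ext (by simp)))
  | ⟨v + 2, _⟩ => Or.inr (Or.inr (by simp))

/-! ### The auxiliary coordinate change `Ψ = (c⁻¹ ∂₁f, c⁻¹ ∂₀f, x₂, …)` and the critical section -/

variable {n : ℕ} {c : k} {f : MvPowerSeries (Fin (n + 2)) k} {Ψ : Fin (n + 2) → MvPowerSeries (Fin (n + 2)) k}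
  (hΨ : ∀ i, Ψ i = if (i : ℕ) = 0 then c⁻¹ • pd 1 f else if (i : ℕ) = 1 then c⁻¹ • pd 0 f else X i)

include hΨ in
/-- Slot `0` of `Ψ`. -/
theorem gradChange_zero : Ψ 0 = c⁻¹ • pd 1 f := by
  rw [hΨ]; simp

include hΨ in
/-- Slot `1` of `Ψ`. -/
theorem gradChange_one : Ψ 1 = c⁻¹ • pd 0 f := by
  rw [hΨ]; simp

include hΨ in
/-- Slots `≥ 2` of `Ψ`. -/
theorem gradChange_of_two_le {i : Fin (n + 2)} (hi : 2 ≤ (i : ℕ)) : Ψ i = X i := by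
  rw [hΨ]; simp [show (i : ℕ) ≠ 0 by omega, show (i : ℕ) ≠ 1 by omega]

include hΨ in
/-- `Ψ` has zero constant terms (as `f` has no linear terms). -/
theorem constantCoeff_gradChange (hf1 : ∀ i, coeff (Finsupp.single i 1) f = 0) (i : Fin (n + 2)) :
    constantCoeff (Ψ i) = 0 := by
  have hpd : ∀ j, constantCoeff (pd j f) = 0 := fun j => by
    rw [← coeff_zero_eq_constantCoeff_apply, coeff_pd, zero_add, hf1, mul_zero]
  rcases fin_cases_two i with rfl | rfl | hi
  · rw [gradChange_zero hΨ, constantCoeff_smul, hpd, smul_zero]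
  · rw [gradChange_one hΨ, constantCoeff_smul, hpd, smul_zero]
  · rw [gradChange_of_two_le hΨ hi, constantCoeff_X]

include hΨ in
/-- The linear part of `Ψ` is unit upper-triangular (uses `coeff x₀² = 0`). -/
theorem isUnit_det_linMat_gradChange (h20 : coeff (Finsupp.single 0 2) f = 0)
    (hc : coeff (Finsupp.single 0 1 + Finsupp.single 1 1) f = c) (hc0 : c ≠ 0) :
    IsUnit (FormalCoordChange.linMat Ψ).det := by
  apply isUnit_det_of_unitriangular
  · intro i j hij
    rw [FormalCoordChange.linMat, Matrix.of_apply]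
    have hij' : (j : ℕ) < i := Fin.lt_def.mp hij
    rcases fin_cases_two i with rfl | rfl | hi
    · simp at hij'
    · have hj : j = 0 := Fin.ext (by simpa using hij')
      subst hj
      rw [gradChange_one hΨ, map_smul, coeff_pd, Finsupp.single_eq_same, ← Finsupp.single_add,
        one_add_one_eq_two, h20, mul_zero, smul_zero]
    · rw [gradChange_of_two_le hΨ hi, coeff_index_single_X, if_neg (ne_of_lt hij)]
  · intro i
    rw [FormalCoordChange.linMat, Matrix.of_apply]
    rcases fin_cases_two i with rfl | rfl | hi
    · rw [gradChange_zero hΨ, map_smul, coeff_pd, Finsupp.single_apply, if_neg Fin.zero_ne_one, smul_eq_mul,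
        zero_add, Nat.cast_one, one_mul, hc, inv_mul_cancel₀ hc0]
    · rw [gradChange_one hΨ, map_smul, coeff_pd, Finsupp.single_apply, if_neg Fin.zero_ne_one.symm,
        add_comm (Finsupp.single 1 1), smul_eq_mul, zero_add, Nat.cast_one, one_mul, hc, inv_mul_cancel₀ hc0]
    · rw [gradChange_of_two_le hΨ hi, coeff_index_single_self_X]

/-! The FAR substitution `φ` keeps the variables of index `≥ 2` and kills `x₀, x₁`; the NEAR
substitution `π` keeps `x₀, x₁` and kills the variables of index `≥ 2`. -/
variable {φ π : Fin (n + 2) → MvPowerSeries (Fin (n + 2)) k}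
  (hφ : ∀ i, φ i = if 2 ≤ (i : ℕ) then X i else 0) (hπ : ∀ i, π i = if (i : ℕ) < 2 then X i else 0)

include hφ in
/-- `φ` kills `x₀, x₁`. -/
theorem far_of_lt {i : Fin (n + 2)} (hi : (i : ℕ) < 2) : φ i = 0 := by
  rw [hφ, if_neg (show ¬ 2 ≤ (i : ℕ) by omega)]

include hφ in
/-- `φ` keeps the variables of index `≥ 2`. -/
theorem far_of_le {i : Fin (n + 2)} (hi : 2 ≤ (i : ℕ)) : φ i = X i := by
  rw [hφ, if_pos hi]

include hφ in
/-- THE CRITICAL SECTION: a family `τ = (A, B, x₂, …, x_{n+1})` of series in the variables of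
index `≥ 2` only, with zero constant terms, along which `∂₀f` and `∂₁f` vanish. -/
theorem exists_section (hf : CobordantGame.IsSingular k f) (h20 : coeff (Finsupp.single 0 2) f = 0)
    (hc : coeff (Finsupp.single 0 1 + Finsupp.single 1 1) f ≠ 0) :
    ∃ τ : Fin (n + 2) → MvPowerSeries (Fin (n + 2)) k, (∀ i, constantCoeff (τ i) = 0) ∧
      (∀ i, subst φ (τ i) = τ i) ∧ (∀ i : Fin (n + 2), 2 ≤ (i : ℕ) → τ i = X i) ∧
      subst τ (pd 0 f) = 0 ∧ subst τ (pd 1 f) = 0 := by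
  set c := coeff (Finsupp.single 0 1 + Finsupp.single 1 1) f with hc_def
  obtain ⟨Ψ, hΨ⟩ : ∃ Ψ : Fin (n + 2) → MvPowerSeries (Fin (n + 2)) k,
      ∀ i, Ψ i = if (i : ℕ) = 0 then c⁻¹ • pd 1 f else if (i : ℕ) = 1 then c⁻¹ • pd 0 f else X i :=
    ⟨_, fun _ => rfl⟩
  obtain ⟨ψ, hψ0, hψΨ, -⟩ := FormalCoordChange.exists_comp_inverse (constantCoeff_gradChange hΨ hf.2.2)
    (isUnit_det_linMat_gradChange hΨ h20 hc_def.symm hc)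
  have hfars : HasSubst φ := hasSubst_indSubst hφ
  have hψX : ∀ i : Fin (n + 2), 2 ≤ (i : ℕ) → ψ i = X i := fun i hi => by
    have := hψΨ i
    rwa [gradChange_of_two_le hΨ hi, subst_X (hasSubst_of_constantCoeff_zero hψ0)] at this
  have hτ0 : ∀ i, constantCoeff (subst φ (ψ i)) = 0 := fun i =>
    constantCoeff_subst_eq_zero hfars (constantCoeff_indSubst hφ) (hψ0 i)
  have hτs : HasSubst (fun i => subst φ (ψ i)) := hasSubst_of_constantCoeff_zero hτ0
  have key : ∀ s, subst (fun i => subst φ (ψ i)) (Ψ s) = φ s := fun s => by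
    rw [← subst_subst_eq_subst_comp hψ0 (constantCoeff_indSubst hφ), hψΨ s, subst_X hfars]
  refine ⟨fun i => subst φ (ψ i), hτ0, fun i => subst_indSubst_idem hφ (ψ i), fun i hi => ?_, ?_, ?_⟩
  · show subst φ (ψ i) = X i
    rw [hψX i hi, subst_X hfars, far_of_le hφ hi]
  · have h1 := key 1
    rw [gradChange_one hΨ, subst_smul hτs, far_of_lt hφ (by simp)] at h1
    exact (smul_eq_zero.mp h1).resolve_left (inv_ne_zero hc)
  · have h0 := key 0
    rw [gradChange_zero hΨ, subst_smul hτs, far_of_lt hφ (by simp)] at h0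
    exact (smul_eq_zero.mp h0).resolve_left (inv_ne_zero hc)

/-! ### The translation `θ = (x₀ + τ₀, x₁ + τ₁, x₂, …, x_{n+1})` along the section -/

variable {τ θ : Fin (n + 2) → MvPowerSeries (Fin (n + 2)) k}
  (hθ : ∀ i, θ i = X i + if (i : ℕ) < 2 then τ i else 0) (hτ0 : ∀ i, constantCoeff (τ i) = 0)
  (hτfar : ∀ i, subst φ (τ i) = τ i) (hτX : ∀ i : Fin (n + 2), 2 ≤ (i : ℕ) → τ i = X i)

include hθ hτ0 in
/-- `θ` has zero constant terms. -/
theorem constantCoeff_shift (i : Fin (n + 2)) : constantCoeff (θ i) = 0 := by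
  rw [hθ]; split_ifs <;> simp [constantCoeff_X, hτ0]

include hφ hθ hτfar in
/-- The linear part of `θ` is the identity below and on the diagonal (`A, B` are far series,
without linear terms in the near directions). -/
theorem coeff_single_shift (i j : Fin (n + 2)) (h : (j : ℕ) < 2 ∨ 2 ≤ (i : ℕ)) :
    coeff (Finsupp.single j 1) (θ i) = if j = i then 1 else 0 := by
  rw [hθ, map_add, coeff_index_single_X]
  rcases Nat.lt_or_ge (i : ℕ) 2 with hi | hi
  · rw [if_pos hi, ← hτfar i, coeff_subst_indSubst_of_not hφ (τ i) (i := j) (by simp) (by omega), add_zero]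
  · rw [if_neg (show ¬ (i : ℕ) < 2 by omega), map_zero, add_zero]

include hφ hθ hτfar in
/-- The linear part of `θ` is unit upper-triangular. -/
theorem isUnit_det_linMat_shift : IsUnit (Matrix.det (Matrix.of fun i j => coeff (Finsupp.single j 1) (θ i))) :=
  isUnit_det_of_unitriangular _
    (fun i j hij => by
      have hij' : (j : ℕ) < i := Fin.lt_def.mp hij
      rw [Matrix.of_apply, coeff_single_shift hφ hθ hτfar i j (by omega), if_neg (ne_of_lt hij)])
    (fun i => by rw [Matrix.of_apply, coeff_single_shift hφ hθ hτfar i i (by omega), if_pos rfl])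

include hφ hθ hτ0 hτfar hτX in
/-- Restricting `g ∘ θ` to `x₀ = x₁ = 0` is evaluating `g` along the section `τ`. -/
theorem subst_far_subst_shift (g : MvPowerSeries (Fin (n + 2)) k) : subst φ (subst θ g) = subst τ g := by
  have hfars : HasSubst φ := hasSubst_indSubst hφ
  rw [subst_subst_eq_subst_comp (constantCoeff_shift hθ hτ0) (constantCoeff_indSubst hφ) g]
  congr 1
  funext i
  rw [hθ i, subst_add hfars, subst_X hfars]
  split_ifs with hi
  · rw [far_of_lt hφ hi, zero_add, hτfar]
  · rw [far_of_le hφ (by omega), ← coe_substAlgHom hfars, map_zero, add_zero, hτX i (by omega)]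

include hφ hπ hθ hτ0 hτfar in
/-- Killing the far variables commutes `θ` away: `π ∘ (g ∘ θ) = π ∘ g`. -/
theorem subst_near_subst_shift (g : MvPowerSeries (Fin (n + 2)) k) : subst π (subst θ g) = subst π g := by
  have hnears : HasSubst π := hasSubst_indSubst hπ
  rw [subst_subst_eq_subst_comp (constantCoeff_shift hθ hτ0) (constantCoeff_indSubst hπ) g]
  congr 1
  funext i
  rw [hθ i, subst_add hnears, subst_X hnears]
  split_ifs with hi
  · rw [← hτfar i, subst_indSubst_subst_indSubst_of_disjoint hφ hπ (fun j hj => by omega) (hτ0 i), add_zero]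
  · rw [← coe_substAlgHom hnears, map_zero, add_zero]

include hφ hθ hτ0 hτfar in
/-- CHAIN RULE along the translation: `∂ⱼ (g ∘ θ) = (∂ⱼ g) ∘ θ` for the near directions `j`. -/
theorem pd_subst_shift {j : Fin (n + 2)} (hj : (j : ℕ) < 2) (g : MvPowerSeries (Fin (n + 2)) k) :
    pd j (subst θ g) = subst θ (pd j g) := by
  rw [pd_subst θ (constantCoeff_shift hθ hτ0) g j]
  have hθ' : ∀ i, pd j (θ i) = if i = j then 1 else 0 := fun i => by
    have hkill : pd j (τ i) = 0 := by
      rw [← hτfar i]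
      exact pd_subst_indSubst hφ (by omega) (τ i)
    rw [hθ i, map_add, pd_X]
    split_ifs <;> simp [hkill]
  simp_rw [hθ', mul_ite, mul_one, mul_zero, Finset.sum_ite_eq', Finset.mem_univ, if_true]

include hφ hθ hτ0 hτfar hτX in
/-- NO DEGREE-ONE TERMS IN `(x₀, x₁)`: if `(∂ⱼ f)(τ) = 0` for the near slot `j` carrying the single
near unit of `d`, then the coefficient of `f ∘ θ` at `d` vanishes. -/
theorem coeff_subst_shift_eq_zero {j : Fin (n + 2)} (hj : (j : ℕ) < 2) (hpd : subst τ (pd j f) = 0)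
    {d : Fin (n + 2) →₀ ℕ} (hd : d 0 + d 1 = 1) (hdj : d j = 1) : coeff d (subst θ f) = 0 := by
  rw [← Finsupp.sub_add_single_one_cancel (show d j ≠ 0 by omega)]
  set e := d - Finsupp.single j 1 with he_def
  have he : ∀ i ∈ e.support, 2 ≤ (i : ℕ) := by
    intro i hi
    by_contra hlt
    rw [Finsupp.mem_support_iff, he_def, Finsupp.tsub_apply, Finsupp.single_apply] at hi
    by_cases hij : j = i
    · subst hij
      rw [if_pos rfl] at hi
      omega
    · have hdi : d i = 0 := by
        rcases fin_cases_two i with rfl | rfl | h <;> rcases fin_cases_two j with rfl | rfl | h' <;> omega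
      rw [if_neg hij, hdi] at hi
      omega
  have hej : e j = 0 := by
    rw [he_def, Finsupp.tsub_apply, Finsupp.single_eq_same]
    omega
  have h1 : coeff (e + Finsupp.single j 1) (subst θ f) = coeff e (pd j (subst θ f)) := by
    rw [coeff_pd, hej]
    simp
  rw [h1, pd_subst_shift hφ hθ hτ0 hτfar hj, ← coeff_subst_indSubst_of_forall hφ _ he,
    subst_far_subst_shift hφ hθ hτ0 hτfar hτX, hpd, map_zero]

include hφ hθ hτ0 hτfar in
/-- PURE `(x₀, x₁)` COEFFICIENTS ARE UNCHANGED by the translation along the section. -/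
theorem coeff_subst_shift_of_near (g : MvPowerSeries (Fin (n + 2)) k) {E : Fin (n + 2) →₀ ℕ}
    (hE : ∀ i : Fin (n + 2), 2 ≤ (i : ℕ) → E i = 0) : coeff E (subst θ g) = coeff E g := by
  have hE' : ∀ i ∈ E.support, (i : ℕ) < 2 := fun i hi => by
    by_contra h
    exact (Finsupp.mem_support_iff.mp hi) (hE i (by omega))
  obtain ⟨π, hπ⟩ : ∃ π : Fin (n + 2) → MvPowerSeries (Fin (n + 2)) k, ∀ i, π i = if (i : ℕ) < 2 then X i else 0 :=
    ⟨_, fun _ => rfl⟩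
  rw [← coeff_subst_indSubst_of_forall hπ (subst θ g) hE', subst_near_subst_shift hφ hπ hθ hτ0 hτfar g,
    coeff_subst_indSubst_of_forall hπ g hE']

end CriticalSection

/-- Stub `stub_criticalSection` of the skeleton `LocalWeightedDrop` (line `hasse-ridge-face-selection`):
the FIRST HALF OF THE FORMAL MORSE LEMMA WITH PARAMETERS, over any field.  If the tangent quadric of
a singular germ `f ∈ k[[x₀, …, x_{n+1}]]` has no `x₀²`, no `x₁²` and a non-zero `x₀x₁` coefficient,
then after the legal coordinate change `θ = (x₀ + A(x''), x₁ + B(x''), x'')` translating along the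
formal critical section (`(∂₀f)(A, B, x'') = 0 = (∂₁f)(A, B, x'')`), `f ∘ θ` keeps the three quadric
coefficients and has no monomial of degree exactly one in `(x₀, x₁)`. -/
theorem stub_criticalSection : ∀ (k : Type) [Field k] (n : ℕ) (f : MvPowerSeries (Fin (n + 2)) k),
    CobordantGame.IsSingular k f →
    MvPowerSeries.coeff (Finsupp.single 0 2) f = 0 → MvPowerSeries.coeff (Finsupp.single 1 2) f = 0 →
    MvPowerSeries.coeff (Finsupp.single 0 1 + Finsupp.single 1 1) f ≠ 0 →
    ∃ θ : Fin (n + 2) → MvPowerSeries (Fin (n + 2)) k, (∀ i, MvPowerSeries.constantCoeff (θ i) = 0) ∧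
      IsUnit (Matrix.det (Matrix.of fun i j => MvPowerSeries.coeff (Finsupp.single j 1) (θ i))) ∧
      MvPowerSeries.coeff (Finsupp.single 0 2) (MvPowerSeries.subst θ f) = 0 ∧
      MvPowerSeries.coeff (Finsupp.single 1 2) (MvPowerSeries.subst θ f) = 0 ∧
      MvPowerSeries.coeff (Finsupp.single 0 1 + Finsupp.single 1 1) (MvPowerSeries.subst θ f) ≠ 0 ∧
      ∀ d : Fin (n + 2) →₀ ℕ, d 0 + d 1 = 1 → MvPowerSeries.coeff d (MvPowerSeries.subst θ f) = 0 := by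
  intro k _ n f hf h20 h02 hc
  obtain ⟨φ, hφ⟩ : ∃ φ : Fin (n + 2) → MvPowerSeries (Fin (n + 2)) k,
      ∀ i, φ i = if 2 ≤ (i : ℕ) then MvPowerSeries.X i else 0 := ⟨_, fun _ => rfl⟩
  obtain ⟨τ, hτ0, hτfar, hτX, hpd0, hpd1⟩ := CriticalSection.exists_section hφ hf h20 hc
  obtain ⟨θ, hθ⟩ : ∃ θ : Fin (n + 2) → MvPowerSeries (Fin (n + 2)) k,
      ∀ i, θ i = MvPowerSeries.X i + if (i : ℕ) < 2 then τ i else 0 := ⟨_, fun _ => rfl⟩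
  have hne : ∀ i : Fin (n + 2), 2 ≤ (i : ℕ) → (0 : Fin (n + 2)) ≠ i ∧ (1 : Fin (n + 2)) ≠ i :=
    fun i hi => ⟨fun h => by simp [← h] at hi, fun h => by simp [← h] at hi⟩
  have hnear := fun (E : Fin (n + 2) →₀ ℕ) => CriticalSection.coeff_subst_shift_of_near hφ hθ hτ0 hτfar f (E := E)
  refine ⟨θ, CriticalSection.constantCoeff_shift hθ hτ0, CriticalSection.isUnit_det_linMat_shift hφ hθ hτfar,
    ?_, ?_, ?_, fun d hd => ?_⟩
  · rw [hnear _ fun i hi => Finsupp.single_eq_of_ne' (hne i hi).1, h20]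
  · rw [hnear _ fun i hi => Finsupp.single_eq_of_ne' (hne i hi).2, h02]
  · rw [hnear _ fun i hi => by rw [Finsupp.add_apply, Finsupp.single_eq_of_ne' (hne i hi).1,
      Finsupp.single_eq_of_ne' (hne i hi).2, add_zero]]
    exact hc
  · rcases Nat.eq_zero_or_pos (d 0) with h0 | h0
    · exact CriticalSection.coeff_subst_shift_eq_zero hφ hθ hτ0 hτfar hτX (j := 1) (by simp) hpd1 hd (by omega)
    · exact CriticalSection.coeff_subst_shift_eq_zero hφ hθ hτ0 hτfar hτX (j := 0) (by simp) hpd0 hd (by omega)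

end Summit.ResolutionOfSingularities.ResolutionOfSingularities.Theorems
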